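import Summits.QuantumFields.QCD.Theses.HeatSlicedQuarks
import Summits.QuantumFields.QCD.Theorems.HeatSlicedQuarksQuarkLoopCoefficientDefs
import Summits.QuantumFields.QCD.Theorems.HeatSlicedQuarksQuarkLoopCoefficientHeatSeries
import Summits.QuantumFields.QCD.Theorems.HeatSlicedQuarksQuarkLoopCoefficientHeatSeriesB

/-!
# Finite propagation speed of the exponential-series heat kernel on `ℤ⁴`
(line `Sketch` of crux stmt-QuantumFields-16786, Duhamel layer, part 1)

For a link field `u` with `‖u e‖ ≤ 1` the kernel powers `Hⁿ(x,y) = sqKerPow u n x y` vanish unless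
`|y − x|₁ ≤ 2n` (each factor `H = D♯D` has range two), hence the exponential series
`heatKer u t x y = Σₙ (−t)ⁿ/n! Hⁿ(x,y)` obeys, for every `λ ≥ 0`, the locality bound
`‖K_t(x,y)_{αβ}‖ ≤ e^{−λ|y−x|₁} · exp(e^{2λ} R |t|)`, `R = 1679616`
(weighted exponential series: `Rⁿ · 𝟙[|y−x|₁ ≤ 2n] ≤ e^{−λ|y−x|₁} (e^{2λ} R)ⁿ`).

Mathlib + the Defs file + the shared series layer (`norm_sqKerPow_le`, `heatKer_apply`).
-/

noncomputable section

namespace Summit.QuantumFields.QCD.Cruxes.QuarkLoopCoefficient.Sketch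

open Literature.MathematicalPhysics.QuantumLattice Literature.MathematicalPhysics.QuantumFieldTheory
open Literature.Probability.LatticeModels (Site TorusSite)
open Summit.QuantumFields.QCD.Theorems.QuarkLoopCoefficient
open Summit.QuantumFields.QCD.Cruxes.QuarkLoopCoefficient.Sketch.HeatSeries
open scoped Matrix ComplexConjugate

namespace HeatLocality

/-! ## §1 The `ℓ¹` distance on `ℤ⁴` -/

/-- Triangle inequality for the `ℓ¹` distance `|z − x|₁ ≤ |y − x|₁ + |z − y|₁`. -/
theorem l1_triangle (x y z : Site 4) :
    ∑ μ : Fin 4, |z μ - x μ| ≤ ∑ μ : Fin 4, |y μ - x μ| + ∑ μ : Fin 4, |z μ - y μ| := by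
  rw [← Finset.sum_add_distrib]
  refine Finset.sum_le_sum fun μ _ => ?_
  have h := abs_add_le (y μ - x μ) (z μ - y μ)
  rwa [show y μ - x μ + (z μ - y μ) = z μ - x μ by ring] at h

/-- Points of the range-one neighbourhood are at `ℓ¹` distance at most one. -/
theorem l1_le_one_of_mem_nbr {x y : Site 4} (h : y ∈ nbr x) : ∑ μ : Fin 4, |y μ - x μ| ≤ 1 := by
  rcases mem_nbr.mp h with rfl | ⟨μ, rfl | rfl⟩
  · simp
  · fin_cases μ <;> simp [Fin.sum_univ_four, Pi.single_apply]
  · fin_cases μ <;> simp [Fin.sum_univ_four, Pi.single_apply]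

/-- Points of the range-two neighbourhood are at `ℓ¹` distance at most two. -/
theorem l1_le_two_of_mem_nbr2 {x y : Site 4} (h : y ∈ nbr2 x) : ∑ μ : Fin 4, |y μ - x μ| ≤ 2 := by
  obtain ⟨z, hz, hy⟩ := mem_nbr2.mp h
  have h3 := l1_triangle x z y
  have h1 := l1_le_one_of_mem_nbr hz
  have h2 := l1_le_one_of_mem_nbr hy
  linarith

/-- The real form of the `ℓ¹` distance used in the statements of the line is the cast of the
integer one. -/
theorem l1_cast (x y : Site 4) :
    (∑ μ : Fin 4, |((y μ - x μ : ℤ) : ℝ)|) = ((∑ μ : Fin 4, |y μ - x μ| : ℤ) : ℝ) := by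
  push_cast
  rfl

/-! ## §2 Support of the kernel powers -/

variable {u : LGConfig 4 ℂ}

/-- **Finite propagation speed**: `Hⁿ(x,y) ≠ 0` forces `|y − x|₁ ≤ 2n` (induction on `n`: each
factor `H(x,·)` is supported in `nbr2 x`, a set of `ℓ¹`-radius two). -/
theorem l1_le_of_sqKerPow_ne_zero :
    ∀ (n : ℕ) (x y : Site 4), sqKerPow u n x y ≠ 0 → ∑ μ : Fin 4, |y μ - x μ| ≤ 2 * (n : ℤ) := by
  intro n
  induction n with
  | zero =>
    intro x y h
    rw [sqKerPow_zero_apply] at h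
    by_cases hxy : x = y
    · subst hxy; simp
    · exact absurd (if_neg hxy) h
  | succ n ih =>
    intro x y h
    rw [sqKerPow_succ] at h
    obtain ⟨z, hz, hne⟩ := Finset.exists_ne_zero_of_sum_ne_zero h
    have hzy : sqKerPow u n z y ≠ 0 := fun e => hne (by rw [e, Matrix.mul_zero])
    have h1 := ih z y hzy
    have h2 := l1_le_two_of_mem_nbr2 hz
    have h3 := l1_triangle x z y
    push_cast
    linarith

/-- Contrapositive form: beyond `ℓ¹` distance `2n` the kernel power vanishes. -/
theorem sqKerPow_eq_zero_of_lt {n : ℕ} {x y : Site 4}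
    (h : 2 * (n : ℤ) < ∑ μ : Fin 4, |y μ - x μ|) : sqKerPow u n x y = 0 := by
  by_contra hne
  exact absurd (l1_le_of_sqKerPow_ne_zero n x y hne) (not_le.mpr h)

/-! ## §3 The weighted series bound -/

/-- Termwise weighted bound: `‖Hⁿ(x,y)_{αβ}‖ ≤ e^{−λ d} (e^{2λ} R)ⁿ`, `d = |y − x|₁`, for `λ ≥ 0`
(if the entry is nonzero then `d ≤ 2n`, so the weight `e^{−λd} e^{2λn}` is at least one). -/
theorem norm_sqKerPow_le_weighted (hu : ∀ e, ‖u e‖ ≤ 1) {lam : ℝ} (hlam : 0 ≤ lam) (n : ℕ)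
    (x y : Site 4) (α β : Fin 4) :
    ‖sqKerPow u n x y α β‖ ≤ Real.exp (-(lam * ∑ μ : Fin 4, |((y μ - x μ : ℤ) : ℝ)|)) *
      (Real.exp (2 * lam) * 1679616) ^ n := by
  by_cases hz : sqKerPow u n x y = 0
  · rw [hz, Matrix.zero_apply, norm_zero]; positivity
  · have hd := l1_le_of_sqKerPow_ne_zero n x y hz
    have hd' : (∑ μ : Fin 4, |((y μ - x μ : ℤ) : ℝ)|) ≤ 2 * (n : ℝ) := by
      rw [l1_cast]; exact_mod_cast hd
    have hone : 1 ≤ Real.exp (-(lam * ∑ μ : Fin 4, |((y μ - x μ : ℤ) : ℝ)|)) *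
        Real.exp (2 * lam) ^ n := by
      rw [← Real.exp_nat_mul, ← Real.exp_add]
      refine Real.one_le_exp ?_
      have := mul_le_mul_of_nonneg_left hd' hlam
      linarith
    calc ‖sqKerPow u n x y α β‖ ≤ (1679616 : ℝ) ^ n := norm_sqKerPow_le hu n x y α β
      _ ≤ (Real.exp (-(lam * ∑ μ : Fin 4, |((y μ - x μ : ℤ) : ℝ)|)) * Real.exp (2 * lam) ^ n) *
            1679616 ^ n := le_mul_of_one_le_left (by positivity) hone
      _ = _ := by rw [mul_pow]; ring

/-- **Locality bound of the heat kernel**: for `λ ≥ 0`,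
`‖K_t(x,y)_{αβ}‖ ≤ e^{−λ|y−x|₁} exp(e^{2λ} R |t|)` (compare the series termwise with the
exponential series of `e^{2λ} R |t|`). -/
theorem norm_heatKer_apply_le_exp (hu : ∀ e, ‖u e‖ ≤ 1) {lam : ℝ} (hlam : 0 ≤ lam) (t : ℝ)
    (x y : Site 4) (α β : Fin 4) :
    ‖heatKer u t x y α β‖ ≤ Real.exp (-(lam * ∑ μ : Fin 4, |((y μ - x μ : ℤ) : ℝ)|)) *
      Real.exp (Real.exp (2 * lam) * 1679616 * |t|) := by
  rw [heatKer_apply hu]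
  set w : ℝ := Real.exp (-(lam * ∑ μ : Fin 4, |((y μ - x μ : ℤ) : ℝ)|)) with hw
  set a : ℝ := Real.exp (2 * lam) * 1679616 with ha
  have hg : HasSum (fun n : ℕ => w * ((a * |t|) ^ n / (n.factorial : ℝ))) (w * Real.exp (a * |t|)) := by
    refine HasSum.mul_left w ?_
    rw [Real.exp_eq_exp_ℝ]
    exact NormedSpace.expSeries_div_hasSum_exp (a * |t|)
  refine (norm_tsum_le_tsum_norm (summable_heatKer_term hu t x y α β).norm).trans ?_
  refine (Summable.tsum_le_tsum (fun n => ?_) (summable_heatKer_term hu t x y α β).norm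
    hg.summable).trans (le_of_eq hg.tsum_eq)
  rw [norm_mul, norm_coeff]
  calc |t| ^ n / (n.factorial : ℝ) * ‖sqKerPow u n x y α β‖
      ≤ |t| ^ n / (n.factorial : ℝ) * (w * a ^ n) :=
        mul_le_mul_of_nonneg_left (norm_sqKerPow_le_weighted hu hlam n x y α β) (by positivity)
    _ = w * ((a * |t|) ^ n / (n.factorial : ℝ)) := by rw [mul_pow]; ring

end HeatLocality

/-! ## Registered headline -/

/-- **Finite propagation speed of the exponential series** (aux stub `stub_heatLocality` of crux
stmt-QuantumFields-16786, line `Sketch`): for a sub-unimodular link field and every `λ ≥ 0`,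
`‖heatKer u t x y α β‖ ≤ e^{−λ|y−x|₁} · exp(e^{2λ} · 1679616 · |t|)`. -/
theorem stub_heatLocality :
    ∀ (u : LGConfig 4 ℂ), (∀ e, ‖u e‖ ≤ 1) → ∀ (lam : ℝ), 0 ≤ lam → ∀ (t : ℝ) (x y : Site 4) (α β : Fin 4),
      ‖heatKer u t x y α β‖ ≤
        Real.exp (-(lam * ∑ μ : Fin 4, |((y μ - x μ : ℤ) : ℝ)|)) * Real.exp (Real.exp (2 * lam) * 1679616 * |t|) :=
  fun _ hu _ hlam t x y α β => HeatLocality.norm_heatKer_apply_le_exp hu hlam t x y α β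

end Summit.QuantumFields.QCD.Cruxes.QuarkLoopCoefficient.Sketch

end
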